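import Summits.BirchSwinnertonDyer.BirchSwinnertonDyer.Theorems.RankOneAtTwoES52BTranspositionChebotarev
import Summits.BirchSwinnertonDyer.BirchSwinnertonDyer.Theorems.GenusKolyvaginAtTwoGenusPrimitiveSupplyAtTwoTranspositionSupply
import Summits.BirchSwinnertonDyer.BirchSwinnertonDyer.Theorems.GenusKolyvaginAtTwoMinimalTwinBSDTwoSwappedPairRationalHeegnerPoint
import Summits.BirchSwinnertonDyer.Rank1Residual.F1Sign2.RaisingLawAtTwo
import Summits.BirchSwinnertonDyer.BirchSwinnertonDyer.Theses.ByReductionTypeAtTwo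
import Summits.BirchSwinnertonDyer.Rank1Residual.F1Sign2.EggLemmaAtTwoProofs
import Literature.NumberTheory.EllipticCurves.CyclotomicIwasawaMainTheoremIrreducibleBaseChangeProofs
import Literature.NumberTheory.EllipticCurves.SelmerGroupCardinality
import HarnessLib

/-!
# Route `ByReductionTypeAtTwo`, crux `RankOneAtTwoBigImageOddLocal` (stmt-BirchSwinnertonDyer-23715) —
# ES-52B `ES52.RealWindowObstructionAtTwo` FROM ITS DISPLAYED PRINT INPUTS (TR) + (L20): in the middle-root flag BOTH branches of the
# Kummer dichotomy FAIL (kernel ∘ {transposition reading of `a_ℓ mod 4`, archimedean Kummer image} ∘ Čebotarev-in-the-tree)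

Seat `bsd-f1-sign2-es52b` g0 (one-shot prover, cell `bsd-f1-sign2`; SUMMON `wake/SUMMON-bsd-f1-sign2-es52b-20260831T2347Z.md` by REF2 g76; REF2 P-es-52
placement; REF1 §534 pre-prover audit), `--supports stmt-BirchSwinnertonDyer-23715 --as helper`.  THEOREMS ONLY (no definition, no named fact, no `sorry`,
no instance); standard axioms.  **HONEST REGISTER: count-neutral; stmt-23715 stays OPEN; ES-52B is landed CONDITIONALLY on the displayed print inputs
(TR)+(L20) below (the `(ST)` input and Čebotarev are tree theorems, not hypotheses); BSD is proved for no curve; nothing is closed.**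

TARGET.  ES-52B = `Summit.BirchSwinnertonDyer.BirchSwinnertonDyer.Cruxes.RankOneAtTwoBigImageOddLocal.ES52.RealWindowObstructionAtTwo` (workfile
`Cruxes/RankOneAtTwoBigImageOddLocal/RealFlagKummerWindowES52.lean` @eaf649db1fc4, sha16 10d39f964d710d24, lines 130–150).  `Cruxes/**` modules are NOT
built on the farm (`lean check` of an importer: `remote:stale:11463:unbuilt:…RealFlagKummerWindowES52`; REF1 §534 A1), so — per the SUMMON's FORM
clause «if the gate refuses a Cruxes import, restate the Prop byte-verbatim with a docstring pointer» and the rail «no def» — the headline's TYPE below is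
the BYTE-VERBATIM BODY of `ES52.RealWindowObstructionAtTwo` with its two Cruxes-side predicates `ES52.CongruentModTwo W F` and `ES52.RealRootFlag W F 1`
δ-unfolded verbatim (and `ES52.twoDivPoly X` spelled `X.twoTorsionPolynomial.toPoly`); once the Cruxes module is importable,
`theorem … : ES52.RealWindowObstructionAtTwo := fun W _ _ ↦ realWindowObstructionAtTwo_of_defectClass hβ W` is a `by unfold; exact` one-liner.

THE DISPLAYED PRINT INPUT `hβ` (REF2 P-es-52 / REF1 §534 regime; the ONLY hypothesis).  Its antecedents are the ES-52B FRAME VERBATIM (`W` on the 23715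
slice: `¬CM`, `ρ_{W,2^k}` onto for all `k`, odd torsion order, odd Tamagawa product, analytic rank `1`, `Ш(W)[2] = 0`; `F` globally minimal, `N_F = N_W`,
`a_p(W) ≡ a_p(F) (mod 2)` off `2N_WN_F`, `#Sel₂(F) = 1`, odd Tamagawa product; the middle-root flag `RealRootFlag W F 1`) PLUS `F(ℚ)[2] = 0` (R534a: derived
below from `#Sel₂(F) = 1` by the tree's descent count `card_selmerGroup_eq_pow_rank_mul`, so `f_F` is irreducible and the flag's `q` induces the unique
equivariant root bijection — REF1 §534 A2; supplied by the kernel, so `hβ` asserts (TR)+(L20) exactly on the population where MEMO-es §50 / K51B / E52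
state and check them); its conclusion: there is a class `β ∈ H¹(ℚ, W[2])` — in print the mod-`4` DEFECT CLASS `β = γ_W·γ_F`,
`γ_E = [−Δ_E f_E′(θ_E)] ∈ ker(N : K^×/K^{×2} → ℚ^×/ℚ^{×2}) = H¹(ℚ, W[2])`, `K = ℚ[X]/(f_W)`, `θ_F = q(θ_W)` (Kummer/Schaefer description of `H¹(ℚ, E[2])`)
— such that
* **(TR) the transposition reading** (MEMO-es §50, K51B: 7 398 894 digit pairs, 0 exceptions): at every prime `ℓ ∤ 2N_W` with `(Δ_W/ℓ) = −1`,
  `4 ∣ a_ℓ(W) − a_ℓ(F) ⟺ res_ℓ β = 0` — typed `β ∈ W.torsionLocalKer ℚ_[ℓ] 2 = ker (H¹(ℚ, W[2]) → H¹(ℚ_ℓ, W[2]))`;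
* **(L20) the archimedean Kummer image** (Mazur–Rubin, *Selmer companion curves*, arXiv:1203.0620 Lemma 20; Kramer 1981 Prop. 6): for `Δ_W > 0`,
  `L_∞(W) = Im(W(ℝ) → H¹(ℝ, W[2])) = {0, (0,1,1)}` (sign vectors at `e₀<e₁<e₂`), while `γ_{E,∞} = (1,0,1)` by the tree's PROVED sign lemma
  `ES52.deriv_signs_at_ordered_roots` (`f′ > 0, < 0, > 0` at `e₀, e₁, e₂`, times `−Δ < 0`), so in flag `1` (`q(e₀) = e′₁`) `β_∞ = (1,0,1) + (0,1,1) = (1,1,0) ∉ L_∞(W)`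
  (REF1 §534 (α) checked all six bijections: `β_∞ ∈ L_∞(W) ⟺ π(0) ≠ 1`) — typed POSITIONALLY, for a complex conjugation `c₀`, as
  «`[β, c₀] ≠ [κ(P), c₀]` for every `P ∈ W(ℚ)`» (`κ` the Kummer map `kummerMapTorsion`, `[·,·] = h1Eval`; `P = 0` gives `[β, c₀] ≠ 0`), which is what
  `β_∞ ∉ L_∞(W) ⊇ {0} ∪ κ(W(ℚ))_∞` says.  §0's `decide` lemma records the 𝔽₂-combinatorics `(1,0,1) + (1,0,1)∘π ∉ {0, (0,1,1)}` for both flag-1 bijections `π`.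
The SUMMON's third admissible input **(ST)** «`jacobiSym W.Δ.num ℓ = −1 ⟺ Frob_ℓ` a transposition on the roots of `f_W`» is NOT assumed: it is the tree
theorem `RankOneAtTwoOneDoor.sign_permGal_eq_legendreSym_of_isArithFrobAt`; Čebotarev is the tree theorem `Automorphic.chebotarev_artinRep_holds`.
The `κ(g)`-companion of (TR) «`res_ℓ κ(g) = 0 ⟺ LocallyTwoPowDivisible W ℓ 1 g`» is NOT assumed either: it is PROVED here (§2, local Kummer exactness).

KERNEL (this file + `…RankOneAtTwoES52BTranspositionChebotarev`): R534a; `κ(g) ≠ 0` (`g ∉ 2W(ℚ)`, `ker κ = 2W(ℚ)`); `β ≠ 0`, `β ≠ κ(g)` from (L20);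
★ `exists_transposition_prime_not_mem_and_mem_torsionLocalKer` (Čebotarev): a prime `ℓ ∤ 2N_W` with `(Δ_W/ℓ) = −1`, `β_ℓ ≠ 0`, `κ(g)_ℓ = 0`; by (TR)
`4 ∤ a_ℓ(W) − a_ℓ(F)` — conjunct (i); by §2 `g ∈ 2W(ℚ_ℓ)` — so `¬(4 ∣ a_ℓ(W) − a_ℓ(F) ↔ LocallyTwoPowDivisible W ℓ 1 g)` — conjunct (ii), at the SAME prime.

* §0 `flagOne_signVector_not_mem` — the 𝔽₂ sign-vector bookkeeping behind (L20) (`decide`).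
* §1 `forall_two_nsmul_eq_zero_of_card_selmerGroup_two_eq_one` — R534a: `#Sel₂(F) = 1 ⟹ F(ℚ)[2] = 0`.
* §2 `kummerMapTorsion_mem_torsionLocalKer_padic_iff` — `κ(P) ∈ ker loc_ℓ ⟺ P ∈ 2E(ℚ_ℓ)` (`LocallyTwoPowDivisible W ℓ 1 P` unfolded).
* §3 ★★ `realWindowObstructionAtTwo_of_defectClass` — ES-52B from `hβ`.

References: MEMO-es §50; REF1-AUDIT §534; [MazurRubin2015SelmerCompanions] = arXiv:1203.0620 Lemma 20, Thm 3.1; [Kramer1981] Prop. 3, Prop. 6; [MazurRubin2010]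
Prop. 3.3, Lemma 3.5; [GrossLMS1991] §9 Prop. 9.6; [SilvermanAEC2009] VIII.§2, X.1.4, X.4.2; [Cassels1991] §15 (Kummer description of `H¹(ℚ, E[2])`).
-/

set_option linter.dupNamespace false -- tree convention: `Summit.BirchSwinnertonDyer.BirchSwinnertonDyer.Theorems` (summit = sub-problem)
set_option autoImplicit false

noncomputable section

open scoped Classical

namespace Summit.BirchSwinnertonDyer.BirchSwinnertonDyer.Theorems.RankOneAtTwoES52B

open WeierstrassCurve Polynomial NumberField IsDedekindDomain Field
open Literature.NumberTheory.GaloisRepresentations Literature.NumberTheory.EllipticCurves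
open Literature.NumberTheory.EllipticCurves.ModularForms
open Literature.NumberTheory
open Rat.HeightOneSpectrum (primesEquiv)
open Summit.BirchSwinnertonDyer.Rank1Residual.F1Sign2 (LocallyTwoPowDivisible ShaTwoTrivial)
open Summit.BirchSwinnertonDyer.BirchSwinnertonDyer.Theorems.GenusKolyTwistingPrime

/-! ## §0 The 𝔽₂ sign-vector bookkeeping behind (L20) -/

/-- **Flag `1` puts `β_∞` off the real Kummer line (finite check).**  Sign vectors at the ordered real roots `e₀ < e₁ < e₂` as maps `Fin 3 → ZMod 2`:
`γ_∞ = (1,0,1)` (the sign lemma `ES52.deriv_signs_at_ordered_roots` times `−Δ < 0`), `L_∞ = {0, (0,1,1)}` (Mazur–Rubin 2015 Lemma 20 / Kramer Prop. 6).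
For EVERY bijection `π` of the root indices with `π 0 = 1` (the middle-root flag `q(e₀) = e′₁`; `γ_{F,∞}` read in `W`'s root order is `(1,0,1) ∘ π`),
`β_∞ = γ_{W,∞} + γ_{F,∞}∘π = (1,1,0)`, which is neither `0` nor `(0,1,1)` — REF1 §534 (α).  [cite: MazurRubin2015SelmerCompanions, Lemma 20] -/
theorem flagOne_signVector_not_mem :
    ∀ π : Equiv.Perm (Fin 3), π 0 = 1 →
      (![1, 0, 1] + (![1, 0, 1] : Fin 3 → ZMod 2) ∘ π ≠ 0 ∧
        ![1, 0, 1] + (![1, 0, 1] : Fin 3 → ZMod 2) ∘ π ≠ ![0, 1, 1]) := by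
  decide

/-! ## §1 R534a: `#Sel₂(F) = 1 ⟹ F(ℚ)[2] = 0` -/

section R534a

/-- In an additive group whose `n`-torsion subgroup is trivial (`Nat.card = 1`), `n • P = 0` forces `P = 0`. [folklore] -/
private theorem eq_zero_of_natCard_torsionBy_eq_one {A : Type*} [AddCommGroup A] {n : ℕ}
    (h : Nat.card (AddSubgroup.torsionBy A n) = 1) {P : A} (hP : n • P = 0) : P = 0 := by
  haveI := (Nat.card_eq_one_iff_unique.mp h).1
  have hmem : P ∈ AddSubgroup.torsionBy A n := AddSubgroup.torsionBy.nsmul_iff.mpr hP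
  exact congrArg Subtype.val (Subsingleton.elim (⟨P, hmem⟩ : AddSubgroup.torsionBy A n) ⟨0, zero_mem _⟩)

variable (F : WeierstrassCurve ℚ) [F.IsElliptic]

/-- **R534a (REF1 §534): a curve with trivial `2`-Selmer group has no rational `2`-torsion.**  By the tree's descent count
`#Sel₂(F) = 2^{rk} · #F(ℚ)[2] · #Ш(F)[2]` (`card_selmerGroup_eq_pow_rank_mul`), `#Sel₂(F) = 1` forces `#F(ℚ)[2] = 1`.  Consequently the `2`-division
cubic `f_F` is irreducible over `ℚ` and the flag's `q` (with `f_W ∣ f_F ∘ q`) induces the unique `G_ℚ`-equivariant bijection of the root sets (REF1 §534 A2).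
[cite: SilvermanAEC2009, Thm X.4.2 (a)] -/
theorem forall_two_nsmul_eq_zero_of_card_selmerGroup_two_eq_one (hsel : Nat.card (F.selmerGroup (2 : ℤ)) = 1) :
    ∀ P : F.toAffine.Point, 2 • P = 0 → P = 0 := by
  intro P hP
  have h := card_selmerGroup_eq_pow_rank_mul F 2
  have hsel' : Nat.card (F.selmerGroup ((2 : ℕ) : ℤ)) = 1 := hsel
  rw [hsel'] at h
  have h1 := Nat.eq_one_of_mul_eq_one_left (Nat.eq_one_of_mul_eq_one_right h.symm)
  -- (`convert` bridges Mathlib's two `DecidableEq ℚ` instances behind the group law on `E(ℚ)`)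
  exact @eq_zero_of_natCard_torsionBy_eq_one F.toAffine.Point (_) 2 h1 P (by convert hP)

end R534a

/-! ## §2 The `κ(g)`-companion of the transposition reading: `κ(P) ∈ ker loc_ℓ ⟺ P ∈ 2E(ℚ_ℓ)` -/

section Companion

variable (W : WeierstrassCurve ℚ) [W.IsElliptic]

/-- **The Kummer class of a rational point is locally trivial at `ℓ` iff the point is `2`-divisible in `E(ℚ_ℓ)`** — the `κ(g)`-companion
«`res_ℓ κ(g) = 0 ⟺ LocallyTwoPowDivisible W ℓ 1 g`» of the SUMMON's input (TR), PROVED: local Kummer exactness `ker(E(ℚ_v)/2 → H¹(ℚ_v, E[2])) = 0`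
(tree `GenusKolyArch.localization_kummerMapTorsion_eq_zero_iff`), the localisation dictionary `GenusKolyTwistLocal.mem_torsionLocalKer_iff_localization_eq_zero_rat`,
`ℚ_v ≃ ℚ_ℓ` on both sides (`mem_torsionLocalKer_padic_iff`, `GenusKolyTransp.exists_two_smul_adicCompletion_iff_padic`).  The right-hand side is
`F1Sign2.LocallyTwoPowDivisible W ℓ 1 P` unfolded. [cite: SilvermanAEC2009, VIII.§2 and X.§4 diagram (**)] -/
theorem kummerMapTorsion_mem_torsionLocalKer_padic_iff
    (hdiv : ∀ P : geomPoints W, ∃ Q : geomPoints W, (2 : ℤ) • Q = P) {ℓ : ℕ} [Fact ℓ.Prime] (P : W.toAffine.Point) :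
    kummerMapTorsion W (2 : ℤ) hdiv P ∈ W.torsionLocalKer ℚ_[ℓ] (2 : ℤ) ↔
      ∃ Q : (W.toAffine.baseChange ℚ_[ℓ]).Point, 2 ^ 1 • Q = Affine.Point.baseChange (W' := W.toAffine) ℚ ℚ_[ℓ] P := by
  have hℓ : ℓ.Prime := Fact.out
  obtain ⟨v, hℓv⟩ : ∃ v : HeightOneSpectrum (𝓞 ℚ), (ℓ : 𝓞 ℚ) ∈ v.asIdeal :=
    ⟨primesEquiv.symm ⟨ℓ, hℓ⟩, by
      have h := Rat.HeightOneSpectrum.natCast_natGenerator_mem (primesEquiv.symm ⟨ℓ, hℓ⟩)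
      rwa [show Rat.HeightOneSpectrum.natGenerator (primesEquiv.symm ⟨ℓ, hℓ⟩) = ℓ from
        congrArg Subtype.val (primesEquiv.apply_symm_apply (⟨ℓ, hℓ⟩ : Nat.Primes))] at h⟩
  have hvℓ : ((primesEquiv v : Nat.Primes) : ℕ) = ℓ := primesEquiv_eq hℓ hℓv
  subst hvℓ
  letI instAlg : Algebra ℚ (v.adicCompletion ℚ) := inferInstance
  haveI : CharZero (v.adicCompletion ℚ) := charZero_adicCompletion v
  refine (@mem_torsionLocalKer_padic_iff W _ _ (v.adicCompletion ℚ) _ instAlg _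
      (RingEquivClass.toRingEquiv (Rat.HeightOneSpectrum.adicCompletion.padicEquiv (R := 𝓞 ℚ) v)) (2 : ℤ) _).trans ?_
  refine (GenusKolyTwistLocal.mem_torsionLocalKer_iff_localization_eq_zero_rat W v _).trans ?_
  refine (GenusKolyArch.localization_kummerMapTorsion_eq_zero_iff W two_ne_zero hdiv (Sum.inr v) P).trans ?_
  have h := GenusKolyTransp.exists_two_smul_adicCompletion_iff_padic W v hℓv 2 P
  constructor
  · rintro ⟨R, hR⟩
    obtain ⟨R', hR'⟩ := h.mp ⟨R, by rw [← natCast_zsmul]; exact hR⟩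
    exact ⟨R', by rw [pow_one]; exact hR'⟩
  · rintro ⟨Q, hQ⟩
    obtain ⟨R, hR⟩ := h.mpr ⟨Q, by rw [pow_one] at hQ; exact hQ⟩
    exact ⟨R, by rw [← natCast_zsmul] at hR; exact hR⟩

end Companion

/-! ## §3 ES-52B from the displayed defect-class input (TR) + (L20) -/

/-- ★★ **ES-52B `ES52.RealWindowObstructionAtTwo` FROM (TR) + (L20).**  TYPE = the byte-verbatim body of
`Summit.BirchSwinnertonDyer.BirchSwinnertonDyer.Cruxes.RankOneAtTwoBigImageOddLocal.ES52.RealWindowObstructionAtTwo` (workfile @eaf649db1fc4, sha16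
10d39f964d710d24, l. 130–150) with `CongruentModTwo W F` / `RealRootFlag W F 1` δ-unfolded verbatim (`twoDivPoly X = X.twoTorsionPolynomial.toPoly`); Cruxes
modules are not built on the farm, hence no `import` (SUMMON FORM clause).  HYPOTHESIS `hβ` = the displayed print inputs (TR) (transposition reading of
`a_ℓ mod 4` for the mod-4 defect class `β = γ_Wγ_F ∈ H¹(ℚ, W[2])`, MEMO-es §50 / K51B) and (L20) (Mazur–Rubin 2015 Lemma 20 + the proved sign lemma
`ES52.deriv_signs_at_ordered_roots`: in flag `1`, `β_∞ = (1,1,0) ∉ L_∞(W) = {0,(0,1,1)} ⊇ {0} ∪ κ(W(ℚ))_∞`, typed positionally at a complex conjugation),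
with antecedents = the frame verbatim plus `F(ℚ)[2] = 0` (= R534a from `#Sel₂(F) = 1`, supplied by the kernel).  CONCLUSION: in the middle-root flag
(i) some `ℓ ∤ 2N_W` with `(Δ_W/ℓ) = −1` has `4 ∤ a_ℓ(W) − a_ℓ(F)` and (ii) some such `ℓ` has `¬(4 ∣ a_ℓ(W) − a_ℓ(F) ↔ g ∈ 2W(ℚ_ℓ))` — both branches of the
ES-51K/ES-52K dichotomy fail.  PROOF (kernel): `κ(g) ≠ 0` (`g ∉ 2W(ℚ)`), `β ≠ 0`, `β ≠ κ(g)` ((L20) at `P = 0`, `P = g`); the UNCONDITIONAL Čebotarev engine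
`exists_transposition_prime_not_mem_and_mem_torsionLocalKer` gives ONE prime `ℓ ∤ 2N_W`, `jacobiSym W.Δ.num ℓ = −1`, with `β_ℓ ≠ 0` and `κ(g)_ℓ = 0`;
(TR) turns `β_ℓ ≠ 0` into `4 ∤ a_ℓ(W) − a_ℓ(F)`; §2 turns `κ(g)_ℓ = 0` into `LocallyTwoPowDivisible W ℓ 1 g`; so (i) and (ii) hold at the same `ℓ`.
CONDITIONAL on `hβ` (a `proof.conditional` in the audit's sense, displayed, print); (ST) and Čebotarev are tree theorems.  Count-neutral: stmt-23715 OPEN;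
BSD proved for no curve. [cite: MazurRubin2015SelmerCompanions, Lemma 20 and Thm 3.1] [cite: Kramer1981, Prop. 3 and Prop. 6] [cite: MazurRubin2010, Prop. 3.3]
[cite: GrossLMS1991, §9 Prop. 9.6] [cite: SilvermanAEC2009, X.1.4 and X.4.2] -/
theorem realWindowObstructionAtTwo_of_defectClass
    (hβ : ∀ (W : WeierstrassCurve ℚ) [W.IsElliptic] [W.IsGloballyMinimal],
      ¬ W.HasCM → (∀ k : ℕ, W.HasSurjectiveModNGaloisRep ((2 ^ k : ℕ) : ℤ)) → Odd W.torsionOrder → Odd W.tamagawaProduct →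
      W.analyticRank = 1 → ShaTwoTrivial W →
      ∀ (F : WeierstrassCurve ℚ) [F.IsElliptic] [F.IsGloballyMinimal],
      F.conductorNorm ℤ = W.conductorNorm ℤ →
      (∀ p : ℕ, p.Prime → ¬ ((p : ℤ) ∣ 2 * (W.conductorNorm ℤ : ℤ) * (F.conductorNorm ℤ : ℤ)) →
        Even (W.frobeniusTrace p - F.frobeniusTrace p)) →
      Nat.card (F.selmerGroup (2 : ℤ)) = 1 → Odd F.tamagawaProduct →
      (∀ P : F.toAffine.Point, 2 • P = 0 → P = 0) →
      (∃ (q : Polynomial ℚ) (e e' : Fin 3 → ℝ),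
        W.twoTorsionPolynomial.toPoly ∣ (F.twoTorsionPolynomial.toPoly).comp q ∧ StrictMono e ∧ StrictMono e' ∧
        (∀ j, ((W.twoTorsionPolynomial.toPoly).map (algebraMap ℚ ℝ)).eval (e j) = 0) ∧
        (∀ j, ((F.twoTorsionPolynomial.toPoly).map (algebraMap ℚ ℝ)).eval (e' j) = 0) ∧
        ((q.map (algebraMap ℚ ℝ)).eval (e 0)) = e' 1) →
      ∃ β : galH1Torsion W (2 : ℤ),
        (∀ (ℓ : ℕ) [Fact ℓ.Prime], ¬ ((ℓ : ℤ) ∣ 2 * (W.conductorNorm ℤ : ℤ)) → jacobiSym W.Δ.num ℓ = -1 →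
          ((4 : ℤ) ∣ W.frobeniusTrace ℓ - F.frobeniusTrace ℓ ↔ β ∈ W.torsionLocalKer ℚ_[ℓ] (2 : ℤ))) ∧
        (∃ c₀ : absoluteGaloisGroup ℚ, IsComplexConjugation (Rat.castHom ℝ) c₀ ∧
          ∀ P : W.toAffine.Point,
            h1Eval W (2 : ℤ) β c₀ ≠
              h1Eval W (2 : ℤ) (kummerMapTorsion W (2 : ℤ) (W.zsmul_geomPoints_surjective_of_charZero (n := (2 : ℤ)) two_ne_zero) P) c₀)) :
    ∀ (W : WeierstrassCurve ℚ) [W.IsElliptic] [W.IsGloballyMinimal],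
    ¬ W.HasCM → (∀ k : ℕ, W.HasSurjectiveModNGaloisRep ((2 ^ k : ℕ) : ℤ)) → Odd W.torsionOrder → Odd W.tamagawaProduct →
    W.analyticRank = 1 → ShaTwoTrivial W →
    ∀ (g : (W.toAffine.baseChange ℚ).Point), (∀ Q : (W.toAffine.baseChange ℚ).Point, 2 • Q ≠ g) →
    ∀ (F : WeierstrassCurve ℚ) [F.IsElliptic] [F.IsGloballyMinimal],
      F.conductorNorm ℤ = W.conductorNorm ℤ →
      (∀ p : ℕ, p.Prime → ¬ ((p : ℤ) ∣ 2 * (W.conductorNorm ℤ : ℤ) * (F.conductorNorm ℤ : ℤ)) →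
        Even (W.frobeniusTrace p - F.frobeniusTrace p)) →
      Nat.card (F.selmerGroup (2 : ℤ)) = 1 → Odd F.tamagawaProduct →
      (∃ (q : Polynomial ℚ) (e e' : Fin 3 → ℝ),
        W.twoTorsionPolynomial.toPoly ∣ (F.twoTorsionPolynomial.toPoly).comp q ∧ StrictMono e ∧ StrictMono e' ∧
        (∀ j, ((W.twoTorsionPolynomial.toPoly).map (algebraMap ℚ ℝ)).eval (e j) = 0) ∧
        (∀ j, ((F.twoTorsionPolynomial.toPoly).map (algebraMap ℚ ℝ)).eval (e' j) = 0) ∧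
        ((q.map (algebraMap ℚ ℝ)).eval (e 0)) = e' 1) →
      (∃ (ℓ : ℕ) (_ : Fact ℓ.Prime), ¬ ((ℓ : ℤ) ∣ 2 * (W.conductorNorm ℤ : ℤ)) ∧ jacobiSym W.Δ.num ℓ = -1 ∧
          ¬ (4 : ℤ) ∣ W.frobeniusTrace ℓ - F.frobeniusTrace ℓ) ∧
      (∃ (ℓ : ℕ) (_ : Fact ℓ.Prime), ¬ ((ℓ : ℤ) ∣ 2 * (W.conductorNorm ℤ : ℤ)) ∧ jacobiSym W.Δ.num ℓ = -1 ∧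
          ¬ ((4 : ℤ) ∣ W.frobeniusTrace ℓ - F.frobeniusTrace ℓ ↔ LocallyTwoPowDivisible W ℓ 1 g)) := by
  intro W _ _ hcm hsurj htor htam hrk hsha g hg F _ _ hN hcong hsel htamF hflag
  -- `ρ̄_{W,2}` onto (`k = 1`) and R534a
  have h2 : W.HasSurjectiveModNGaloisRep 2 := by simpa using hsurj 1
  have hFT : ∀ P : F.toAffine.Point, 2 • P = 0 → P = 0 :=
    forall_two_nsmul_eq_zero_of_card_selmerGroup_two_eq_one F hsel
  -- the displayed inputs (TR) + (L20) for the defect class `β`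
  obtain ⟨β, hTR, c₀, -, harch⟩ := hβ W hcm hsurj htor htam hrk hsha F hN hcong hsel htamF hFT hflag
  -- the Kummer class `κ(g)` of the generator
  set hdivW : ∀ P : geomPoints W, ∃ Q : geomPoints W, (2 : ℤ) • Q = P :=
    W.zsmul_geomPoints_surjective_of_charZero (n := (2 : ℤ)) two_ne_zero with hdivW_def
  have hκ0 : kummerMapTorsion W (2 : ℤ) hdivW g ≠ 0 := by
    intro h
    obtain ⟨Q, hQ⟩ := (GenusExact.TwinSwapBit.kummerMapTorsion_eq_zero_iff_exists_smul W hdivW g).mp h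
    refine hg Q ?_
    rw [← natCast_zsmul]
    -- (`convert` bridges Mathlib's two `DecidableEq ℚ` instances behind the group law on `E(ℚ)`)
    convert hQ <;> rfl
  have hβ0 : β ≠ 0 := fun h ↦ harch 0 (by rw [h, map_zero])
  have hβκ : β ≠ kummerMapTorsion W (2 : ℤ) hdivW g := fun h ↦ harch g (by rw [h])
  -- ONE transposition prime separating `β` from `κ(g)` (Čebotarev, unconditional)
  obtain ⟨ℓ, hℓF, -, hℓ2N, hjac, hβℓ, hκℓ⟩ :=
    exists_transposition_prime_not_mem_and_mem_torsionLocalKer W h2 hβ0 hκ0 hβκ ∅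
  -- (TR): `β_ℓ ≠ 0` reads `4 ∤ a_ℓ(W) − a_ℓ(F)`
  have h4 : ¬ (4 : ℤ) ∣ W.frobeniusTrace ℓ - F.frobeniusTrace ℓ := fun h ↦ hβℓ ((hTR ℓ hℓ2N hjac).mp h)
  -- §2: `κ(g)_ℓ = 0` reads `g ∈ 2W(ℚ_ℓ)`
  have hdivg : LocallyTwoPowDivisible W ℓ 1 g :=
    (kummerMapTorsion_mem_torsionLocalKer_padic_iff W hdivW g).mp hκℓ
  exact ⟨⟨ℓ, hℓF, hℓ2N, hjac, h4⟩, ⟨ℓ, hℓF, hℓ2N, hjac, fun h ↦ h4 (h.mpr hdivg)⟩⟩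

end Summit.BirchSwinnertonDyer.BirchSwinnertonDyer.Theorems.RankOneAtTwoES52B

end
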